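import Mathlib
import Literature.NumberTheory.LFunctions.Zhang2022.Section16BU034L
import Literature.NumberTheory.LFunctions.Zhang2022.Section16NsetRemovableR
import Literature.NumberTheory.LFunctions.Zhang2022.TypedSection15C
import HarnessLib

/-!
# Zhang (2022) §16 p. 93–94: the ROUGH MULTIPLICATIVE MAJORANT (R) of `ϖ₂ⱼ^loc` at `𝔮`-rough prime
# powers — PROVED; hence `Inline16_nsetRemovable` from `Inline16_varpi2WeightSum` alone

Topic `Literature/NumberTheory/LFunctions/Zhang2022` (Landau–Siegel audit tree; verdict-neutral).
Y. Zhang, *Discrete mean estimates and the Landau–Siegel zero*, arXiv:2211.02515v1 (2022)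
[Zhang2022LandauSiegel] — **an unrefereed manuscript under adjudication**; this file PROVES elementary
estimates for the campaign's typed §16 objects and asserts nothing about the manuscript's Theorems 1–2
or about Landau–Siegel zeros. ZHANG-L discharge lane, WP16 (seat zl-w16-p2; ruling W16-S5a (6a)),
Block A/B of leaf h16_16 (binder of record `Eq16_16R2(E)`), sub-leaf `Typed.Section16B.Inline16_nsetRemovable`.

The display after (16.14) (§16 p. 93, tex L4626–L4631) — "if `1 < l < T⁵` and `(l,𝔮) = 1`, then for any
`q∣l`, `ϱ₂ⱼ(l) ≪ α₁ + O(ν(q))` … the innermost sum in (16.14) is `1 + O(𝓛⁻⁷)`" — is USED by the text only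
in summed form; its uniform pointwise reading (`Typed.Section16B.Step16_u036L`) is a claim node, not a
target (ruling RT16-int-3 (e): for a rough prime `q` with `χ(q) = −1`, `|ϖ^loc(q)| ≈ 2|sin(½|β_j|log q)|`
exceeds `Cα𝓛` on `q < T⁵`; for `l = q₁⋯q_k` with `χ(q_i) = 1`, `|ϖ^loc(l)| ≈ 2^k`). What the removal of
the condition `n₁ ∈ 𝒩(𝔮)` in (16.15) consumes is the **rough multiplicative majorant (R)**, stated as the
INLINE hypothesis `hR` of the lane's `inline16_nsetRemovable_of_roughMajorant` (`Section16NsetRemovableR`)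
and as signature S8 of the WP16 sketch of record. PROVED HERE (theorems only; no definitions, no named
facts; Assumption (A) is not used):

* `varpi2loc_prime` — at a prime `q`: `ϖ₂ⱼ^loc(q) = χ(q)·ρ_q(1,q) + λ₂(q)q^{β_j}·ρ_q(q,1)`
  (`ρ_q(d,l) = locRatio c′ χ q d l (1−β_j)`; `ν(q) = 1 + χ(q)` is the tree's `Typed.Section15C.nu_prime`);
* `norm_varpi2loc_prime_sub_nu_le` — for a prime `q ≥ 23`:
  `‖ϖ₂ⱼ^loc(q) − ν(q)‖ ≤ 200/q + ‖β_j‖·log q` (the two twisted local ratios are within `100/q` of `1`,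
  `Section16BLocRatio.norm_lamFlag_mul_locRatio_sub_one_le`; `‖q^{β_j} − 1‖ ≤ ‖β_j‖ log q`, `Re β_j = 0`);
* `norm_varpi2loc_mul_tau3R_prime_pow_le` — for all large `D`, every quadratic `χ`, every `𝔮`-rough prime
  power `q^r < P`: `‖ϖ₂ⱼ^loc(q^r)‖·τ₃(q^r) ≤ (r+1)²(r+2)` (`‖ϖ^loc(m)‖ ≤ 2τ₂(m)`,
  `Section16BU034L.norm_varpi2loc_le`; `τ₃(q^r) = (r+1)(r+2)/2`), and `(r+1)²(r+2) ≤ 1000·(3/2)^r`;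
* **`varpi2loc_roughMajorant`** — (R) with `C₀ = 1000`: for all large `D`, real primitive `χ (mod D)`,
  `j ∈ {1,2}`, `q ∤ 𝔮` prime, `1 ≤ r`, `q^r < T⁵`:
  `‖ϖ₂ⱼ^loc(q^r)‖τ₃(q^r) ≤ 3‖ν(q)‖ + C₀(α log q + q⁻¹)` (`r = 1`), `≤ C₀(3/2)^r` (`r ≥ 2`)
  (`τ₃(q) = 3`, `‖β_j‖ < 5α` by `norm_betaJ_lt_five_alpha`, `T⁵ ≤ P`);
* **`inline16_nsetRemovable_of_weightSum : Inline16_varpi2WeightSum c′ → Inline16_nsetRemovable c′`**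
  and the E-twin `inline16_nsetRemovableE_of_weightSum` — zl-w16-p4's edges with (R) discharged.

## References

* Y. Zhang, arXiv:2211.02515v1 (2022), §16 pp. 93–94, tex L4615–L4640 (u034, the display after (16.14),
  (16.15)). [cite: Zhang2022LandauSiegel, §16 pp.93–94]
-/

noncomputable section

open Complex Real Finset
open Literature.NumberTheory.LFunctions.Zhang2022
open Literature.NumberTheory.LFunctions.Zhang2022.Skeleton
open Literature.NumberTheory.LFunctions.Zhang2022.Typed.Section16A

namespace Literature.NumberTheory.LFunctions.Zhang2022.Typed.Section16B

/-! ## §1. Elementary inequalities -/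

/-- `(r+1)²(r+2) ≤ 1000·(3/2)^r` for every natural `r` (ratio `≤ 3/2` from `r = 6` on; small `r` by
evaluation). [folklore] -/
private theorem sq_succ_mul_le_geom (r : ℕ) : ((r : ℝ) + 1) ^ 2 * ((r : ℝ) + 2) ≤ 1000 * (3 / 2 : ℝ) ^ r := by
  have step : ∀ n : ℕ, 6 ≤ n → ((n : ℝ) + 1) ^ 2 * ((n : ℝ) + 2) ≤ 1000 * (3 / 2 : ℝ) ^ n := by
    intro n hn
    induction n, hn using Nat.le_induction with
    | base => norm_num
    | succ n hn ih =>
      have hn' : (6 : ℝ) ≤ n := by exact_mod_cast hn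
      have h0 : (0 : ℝ) ≤ n := by linarith
      push_cast
      calc ((n : ℝ) + 1 + 1) ^ 2 * ((n : ℝ) + 1 + 2)
          ≤ (3 / 2) * (((n : ℝ) + 1) ^ 2 * ((n : ℝ) + 2)) := by
            nlinarith [mul_nonneg (mul_nonneg h0 h0) (sub_nonneg.2 hn'), mul_nonneg h0 (sub_nonneg.2 hn')]
        _ ≤ (3 / 2) * (1000 * (3 / 2 : ℝ) ^ n) := by gcongr
        _ = 1000 * (3 / 2 : ℝ) ^ (n + 1) := by ring
  by_cases hr : 6 ≤ r
  · exact step r hr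
  · interval_cases r <;> norm_num

/-- `x < T⁵ ⇒ x < P` once `𝓛 ≥ 3` (`5𝓛^{1.1} ≤ 5𝓛² ≤ 𝓛⁹`; cf. the tree's
`Typed.Section15A.bigT_pow_five_le_bigP`). [folklore] -/
private theorem lt_bigP_of_lt_bigT_pow_five {D : ℕ} (hL : 3 ≤ ell D) {x : ℝ} (hx : x < bigT D ^ 5) :
    x < bigP D := by
  refine lt_of_lt_of_le hx ?_
  have hL1 : 1 ≤ ell D := by linarith
  have hL0 : 0 < ell D := by linarith
  have h11 : ell D ^ (1.1 : ℝ) ≤ ell D ^ 2 := by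
    calc ell D ^ (1.1 : ℝ) ≤ ell D ^ ((2 : ℕ) : ℝ) :=
          Real.rpow_le_rpow_of_exponent_le hL1 (by norm_num)
      _ = ell D ^ 2 := Real.rpow_natCast _ 2
  have h7 : (3 : ℝ) ^ 7 ≤ ell D ^ 7 := pow_le_pow_left₀ (by norm_num) hL 7
  have h9 : 5 * ell D ^ 2 ≤ ell D ^ 9 := by
    have e : ell D ^ 9 = ell D ^ 7 * ell D ^ 2 := by ring
    rw [e]; nlinarith [pow_nonneg hL0.le 2]
  rw [bigT, bigP, ← Real.exp_nat_mul]
  exact Real.exp_le_exp.mpr (by push_cast; nlinarith)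

/-- `‖q^w − 1‖ ≤ ‖w‖·log q` for a natural `q ≥ 1` and purely imaginary `w`
(`q^w = e^{i·Im w·log q}`, `|e^{iθ} − 1| ≤ |θ|`). [folklore] -/
private theorem norm_natCast_cpow_sub_one_le_of_re_eq_zero {q : ℕ} (hq : 0 < q) {w : ℂ} (hw : w.re = 0) :
    ‖(q : ℂ) ^ w - 1‖ ≤ ‖w‖ * Real.log q := by
  have hq0 : (q : ℂ) ≠ 0 := by exact_mod_cast hq.ne'
  have hlog : Complex.log (q : ℂ) = (Real.log q : ℂ) := (Complex.natCast_log).symm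
  have hwI : w = (w.im : ℂ) * I := by
    conv_lhs => rw [← Complex.re_add_im w, hw]
    simp
  rw [Complex.cpow_def_of_ne_zero hq0, hlog, hwI,
    show (Real.log q : ℂ) * ((w.im : ℂ) * I) = I * ((Real.log q * w.im : ℝ) : ℂ) by push_cast; ring]
  refine (Real.norm_exp_I_mul_ofReal_sub_one_le).trans ?_
  rw [Real.norm_eq_abs, abs_mul, abs_of_nonneg (Real.log_natCast_nonneg q), norm_mul, Complex.norm_real,
    Complex.norm_I, mul_one, Real.norm_eq_abs, mul_comm]

/-! ## §2. `ϖ₂ⱼ^loc` at a prime -/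

section AtPrime

variable (c' : ℝ) {D : ℕ} (χ : DirichletCharacter ℂ D)

/-- A sum over the divisor pairs of a prime `p` has the two terms `(1,p)` and `(p,1)`. [folklore] -/
private theorem sum_divisorsAntidiagonal_prime {M : Type*} [AddCommMonoid M] {p : ℕ} (hp : p.Prime)
    (f : ℕ × ℕ → M) : ∑ x ∈ p.divisorsAntidiagonal, f x = f (1, p) + f (p, 1) := by
  rw [← Nat.map_div_right_divisors, Finset.sum_map, hp.sum_divisors]
  simp only [Function.Embedding.coeFn_mk, Nat.div_self hp.pos, Nat.div_one]
  rw [add_comm]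

/-- **`ϖ₂ⱼ^loc` at a prime**: `ϖ₂ⱼ^loc(q) = χ(q)·F_q(1,q)/F_q(1,1) + λ₂(q)q^{β_j}·F_q(q,1)/F_q(1,1)` (at
`s = 1 − β_j`; the two divisor pairs `(1,q)`, `(q,1)` of (16.13)'s `Σ_{n=dl}`).
[cite: Zhang2022LandauSiegel, §16 p.93] -/
theorem varpi2loc_prime {q : ℕ} (hq : q.Prime) (j : ℕ) :
    varpi2loc c' χ j q = χ (q : ZMod D) * locRatio c' χ q 1 q (1 - betaJ c' D j) +
      lam2 c' χ q 1 * (q : ℂ) ^ betaJ c' D j * locRatio c' χ q q 1 (1 - betaJ c' D j) := by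
  have h1 : lam2 c' χ 1 1 = 1 := by simp [lam2]
  unfold varpi2loc
  rw [sum_divisorsAntidiagonal_prime hq, hq.primeFactors, Finset.prod_singleton, Finset.prod_singleton]
  simp only [h1, Nat.cast_one, one_cpow, map_one, one_mul, mul_one]

/-- **The rough prime case**: for a prime `q ≥ 23` and any `j`,
`‖ϖ₂ⱼ^loc(q) − ν(q)‖ ≤ 200/q + ‖β_j‖·log q` — from
`ϖ^loc(q) − ν(q) = χ(q)(ρ₀₁ − 1) + q^{β_j}(λ₂(q)ρ₁₀ − 1) + (q^{β_j} − 1)` with the twisted local ratios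
`ρ₀₁ = F_q(1,q)/F_q(1,1)`, `λ₂(q)ρ₁₀ = λ₂(q)F_q(q,1)/F_q(1,1)` within `100/q` of `1`
(`norm_lamFlag_mul_locRatio_sub_one_le`). This is the content of "`ϱ₂ⱼ(l) ≪ α₁ + O(ν(q))`" at `l = q`
(§16 p. 93, display after (16.14)), with the honest `log q` in place of `𝓛`.
[cite: Zhang2022LandauSiegel, §16 p.93] -/
theorem norm_varpi2loc_prime_sub_nu_le {q : ℕ} (hq : q.Prime) (h23 : 23 ≤ q) (j : ℕ) :
    ‖varpi2loc c' χ j q - nu χ q‖ ≤ 200 / (q : ℝ) + ‖betaJ c' D j‖ * Real.log q := by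
  set β : ℂ := betaJ c' D j with hβ
  set ρ01 : ℂ := locRatio c' χ q 1 q (1 - β) with hρ01
  set ρ10 : ℂ := locRatio c' χ q q 1 (1 - β) with hρ10
  have h01 : ‖ρ01 - 1‖ ≤ 100 / (q : ℝ) := by
    have h := norm_lamFlag_mul_locRatio_sub_one_le c' χ hq h23 1 q j
    have hnd : ¬ q ∣ 1 := by rw [Nat.dvd_one]; exact hq.ne_one
    rwa [if_neg hnd, one_mul] at h
  have h10 : ‖lam2 c' χ q 1 * ρ10 - 1‖ ≤ 100 / (q : ℝ) := by
    have h := norm_lamFlag_mul_locRatio_sub_one_le c' χ hq h23 q 1 j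
    rwa [if_pos (dvd_refl q)] at h
  have hqβ : ‖(q : ℂ) ^ β‖ = 1 := Typed.Section15B.norm_natCast_cpow_betaJ c' D j hq.one_lt.le
  have hqβ1 : ‖(q : ℂ) ^ β - 1‖ ≤ ‖β‖ * Real.log q :=
    norm_natCast_cpow_sub_one_le_of_re_eq_zero hq.pos (Typed.Section15B.betaJ_re c' D j)
  have hχ : ‖χ (q : ZMod D)‖ ≤ 1 := DirichletCharacter.norm_le_one χ _
  have e : varpi2loc c' χ j q - nu χ q =
      χ (q : ZMod D) * (ρ01 - 1) + (q : ℂ) ^ β * (lam2 c' χ q 1 * ρ10 - 1) + ((q : ℂ) ^ β - 1) := by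
    rw [varpi2loc_prime c' χ hq j, Typed.Section15C.nu_prime χ hq]
    ring
  rw [e]
  calc ‖χ (q : ZMod D) * (ρ01 - 1) + (q : ℂ) ^ β * (lam2 c' χ q 1 * ρ10 - 1) + ((q : ℂ) ^ β - 1)‖
      ≤ ‖χ (q : ZMod D) * (ρ01 - 1)‖ + ‖(q : ℂ) ^ β * (lam2 c' χ q 1 * ρ10 - 1)‖ + ‖(q : ℂ) ^ β - 1‖ :=
        norm_add₃_le
    _ ≤ 1 * (100 / (q : ℝ)) + 1 * (100 / (q : ℝ)) + ‖β‖ * Real.log q := by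
        rw [norm_mul, norm_mul, hqβ]
        gcongr
    _ = 200 / (q : ℝ) + ‖β‖ * Real.log q := by ring

end AtPrime

/-! ## §3. `ϖ₂ⱼ^loc` at rough prime powers -/

section PrimePowers

variable (c' : ℝ)

/-- `τ₂(q^r) = r + 1` at a prime power. [folklore] -/
private theorem card_divisors_prime_pow {q : ℕ} (hq : q.Prime) (r : ℕ) : (q ^ r).divisors.card = r + 1 := by
  rw [Nat.divisors_prime_pow hq, Finset.card_map, Finset.card_range]

/-- **Rough prime powers**: there is `D₀` such that for all `D ≥ D₀`, every quadratic `χ (mod D)`, every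
`j`, every prime `q ∤ 𝔮` and every `r` with `q^r < P`:
`‖ϖ₂ⱼ^loc(q^r)‖·τ₃(q^r) ≤ (r+1)²(r+2)` (`‖ϖ^loc(m)‖ ≤ 2τ₂(m)` for rough `m < P` — u034 in the local
reading, `norm_varpi2loc_le` — and `τ₃(q^r) = (r+1)(r+2)/2`). [cite: Zhang2022LandauSiegel, §16 p.93 (u034)] -/
theorem norm_varpi2loc_mul_tau3R_prime_pow_le : ∃ D₀ : ℕ, ∀ (D : ℕ) [NeZero D] (χ : DirichletCharacter ℂ D),
    D₀ ≤ D → χ.IsQuadratic → ∀ j q r : ℕ, q.Prime → ¬ q ∣ frakq D → ((q ^ r : ℕ) : ℝ) < bigP D →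
      ‖varpi2loc c' χ j (q ^ r)‖ * tau3R (q ^ r) ≤ ((r : ℝ) + 1) ^ 2 * ((r : ℝ) + 2) := by
  obtain ⟨D₀, h⟩ := norm_varpi2loc_le c'
  refine ⟨D₀, fun D _ χ hD hχ j q r hq hnd hP => ?_⟩
  have hcop : Nat.Coprime (q ^ r) (frakq D) :=
    Nat.Coprime.pow_left r ((Nat.Prime.coprime_iff_not_dvd hq).mpr hnd)
  have h1 : 1 ≤ q ^ r := Nat.one_le_pow r q hq.pos
  have key := h D χ hD hχ j (q ^ r) h1 hcop hP
  rw [card_divisors_prime_pow hq r] at key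
  have hτ := tau3R_prime_pow hq r
  have hτ0 : 0 ≤ tau3R (q ^ r) := by rw [hτ]; positivity
  calc ‖varpi2loc c' χ j (q ^ r)‖ * tau3R (q ^ r) ≤ (2 * ((r + 1 : ℕ) : ℝ)) * tau3R (q ^ r) :=
        mul_le_mul_of_nonneg_right key hτ0
    _ = ((r : ℝ) + 1) ^ 2 * ((r : ℝ) + 2) := by rw [hτ]; push_cast; ring

end PrimePowers

/-! ## §4. The rough multiplicative majorant (R) -/

/-- `q ∤ 𝔮` for a prime `q` means `q ≥ D⁴`. [cite: Zhang2022LandauSiegel, §15 p.84 (𝒬)] -/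
theorem pow_four_le_of_prime_not_dvd_frakq {D q : ℕ} (hq : q.Prime) (hnd : ¬ q ∣ frakq D) : D ^ 4 ≤ q := by
  rw [Typed.Section15B.prime_dvd_frakq_iff hq, not_lt] at hnd
  exact hnd

/-- **(R) — the rough multiplicative majorant of `ϖ₂ⱼ^loc` at `𝔮`-rough prime powers**, with
`C₀ = 1000`: for all large `D`, every real primitive `χ (mod D)` (Assumption (A) is not used),
`j ∈ {1,2}`, every prime `q ∤ 𝔮` (so `q ≥ D⁴`), `r ≥ 1`, `q^r < T⁵`:
`‖ϖ₂ⱼ^loc(q^r)‖·τ₃(q^r) ≤ 3‖ν(q)‖ + C₀(α log q + q⁻¹)` if `r = 1`, and `≤ C₀(3/2)^r` if `r ≥ 2`.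
For `r = 1`: `τ₃(q) = 3` and `‖ϖ^loc(q)‖ ≤ ‖ν(q)‖ + 200/q + ‖β_j‖log q` with `‖β_j‖ < 5α`; for `r ≥ 2`:
`(r+1)²(r+2) ≤ 1000(3/2)^r` (`q^r < T⁵ ≤ P`). This is the summed/multiplicative reading of record
(ruling RT16-int-3 (e)) of "`ϱ₂ⱼ(l) ≪ α₁ + O(ν(q))`, `q∣l`, `1 < l < T⁵`, `(l,𝔮) = 1`" (§16 p. 93, display
after (16.14)) — NOT the printed uniform bound, which fails pointwise; it is exactly the inline hypothesis
`hR` of `inline16_nsetRemovable_of_roughMajorant` and signature S8 of the WP16 sketch.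
[cite: Zhang2022LandauSiegel, §16 pp.93–94] -/
theorem varpi2loc_roughMajorant (c' : ℝ) : ∃ C₀ : ℝ, 0 ≤ C₀ ∧ ForAllLarge fun D _ χ =>
    AssumptionA D χ → ∀ j ∈ ({1, 2} : Finset ℕ), ∀ q r : ℕ, q.Prime → ¬ q ∣ frakq D → 1 ≤ r →
      ((q ^ r : ℕ) : ℝ) < bigT D ^ 5 →
      ‖Typed.Section16B.varpi2loc c' χ j (q ^ r)‖ * Typed.Section16B.tau3R (q ^ r) ≤
        if r = 1 then 3 * ‖nu χ q‖ + C₀ * (alpha D * Real.log q + (q : ℝ)⁻¹)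
        else C₀ * (3 / 2 : ℝ) ^ r := by
  obtain ⟨D₁, h₁⟩ := norm_varpi2loc_mul_tau3R_prime_pow_le c'
  obtain ⟨D₂, h₂⟩ := exists_forall_le_ell (Real.pi * (5 * |c'| + 1) + 3)
  refine ⟨1000, by norm_num, max (max D₁ D₂) 3, fun D _ χ hD hχ _ _ j hj q r hq hnd hr hT => ?_⟩
  have hD₁ : D₁ ≤ D := le_trans (le_trans (le_max_left _ _) (le_max_left _ _)) hD
  have hD₂ : D₂ ≤ D := le_trans (le_trans (le_max_right _ _) (le_max_left _ _)) hD
  have hD3 : 3 ≤ D := le_trans (le_max_right _ _) hD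
  have hℓπ : Real.pi * (5 * |c'| + 1) + 3 ≤ ell D := h₂ D hD₂
  have hπ0 : 0 ≤ Real.pi * (5 * |c'| + 1) := by positivity
  have hℓ3 : 3 ≤ ell D := by linarith
  have hℓ0 : 0 < ell D := by linarith
  have hα0 : 0 < alpha D := Skeleton.alpha_pos_of_ell_pos hℓ0
  -- `q ≥ D⁴ ≥ 81`
  have hq4 : D ^ 4 ≤ q := pow_four_le_of_prime_not_dvd_frakq hq hnd
  have h81 : 81 ≤ D ^ 4 := le_trans (by norm_num) (Nat.pow_le_pow_left hD3 4)
  have h23 : 23 ≤ q := by omega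
  have hq0 : (0 : ℝ) < q := by exact_mod_cast hq.pos
  have hlogq : 0 ≤ Real.log q := Real.log_natCast_nonneg q
  by_cases hr1 : r = 1
  · -- the prime case
    subst hr1
    rw [if_pos rfl, pow_one]
    have hτ : tau3R q = 3 := by
      have := tau3R_prime_pow hq 1
      rw [pow_one] at this; rw [this]; norm_num
    have hβ : ‖betaJ c' D j‖ < 5 * alpha D := norm_betaJ_lt_five_alpha (by linarith) (by linarith) hj
    have hmain := norm_varpi2loc_prime_sub_nu_le c' χ hq h23 j
    have hϖ : ‖varpi2loc c' χ j q‖ ≤ ‖nu χ q‖ + (200 / (q : ℝ) + ‖betaJ c' D j‖ * Real.log q) := by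
      calc ‖varpi2loc c' χ j q‖ = ‖nu χ q + (varpi2loc c' χ j q - nu χ q)‖ := by rw [add_sub_cancel]
        _ ≤ ‖nu χ q‖ + ‖varpi2loc c' χ j q - nu χ q‖ := norm_add_le _ _
        _ ≤ ‖nu χ q‖ + (200 / (q : ℝ) + ‖betaJ c' D j‖ * Real.log q) := by gcongr
    rw [hτ]
    have hβlog : ‖betaJ c' D j‖ * Real.log q ≤ 5 * alpha D * Real.log q :=
      mul_le_mul_of_nonneg_right hβ.le hlogq
    have hinv : 200 / (q : ℝ) = 200 * (q : ℝ)⁻¹ := div_eq_mul_inv _ _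
    have hi0 : 0 ≤ (q : ℝ)⁻¹ := inv_nonneg.mpr hq0.le
    have hαl : 0 ≤ alpha D * Real.log q := mul_nonneg hα0.le hlogq
    nlinarith [hϖ, hβlog, norm_nonneg (varpi2loc c' χ j q), norm_nonneg (nu χ q)]
  · -- prime powers `r ≥ 2`
    rw [if_neg hr1]
    have hP : ((q ^ r : ℕ) : ℝ) < bigP D := lt_bigP_of_lt_bigT_pow_five hℓ3 hT
    exact (h₁ D χ hD₁ hχ j q r hq hnd hP).trans (sq_succ_mul_le_geom r)

/-! ## §5. Consequences: the removal sub-leaf from `Inline16_varpi2WeightSum` alone -/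

/-- **`Inline16_varpi2WeightSum c′ → Inline16_nsetRemovable c′`**: zl-w16-p4's removal edge
`inline16_nsetRemovable_of_roughMajorant` with its hypothesis (R) discharged by `varpi2loc_roughMajorant`.
[cite: Zhang2022LandauSiegel, §16 (16.15) p.94] -/
theorem inline16_nsetRemovable_of_weightSum (c' : ℝ) (hW : Inline16_varpi2WeightSum c') :
    Inline16_nsetRemovable c' :=
  inline16_nsetRemovable_of_roughMajorant c' hW (varpi2loc_roughMajorant c')

/-- **`Inline16_varpi2WeightSum c′ → Inline16_nsetRemovableE e1pp c′`** (the E-twin at any `e1pp`; the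
removal statement is `𝔢`-free). [cite: Zhang2022LandauSiegel, §16 (16.15) p.94] -/
theorem inline16_nsetRemovableE_of_weightSum (e1pp : ℕ → ℂ) (c' : ℝ) (hW : Inline16_varpi2WeightSum c') :
    Inline16_nsetRemovableE e1pp c' :=
  inline16_nsetRemovableE_of_roughMajorant e1pp c' hW (varpi2loc_roughMajorant c')

open scoped Classical in
/-- The `𝔢`-free removal core from `Inline16_varpi2WeightSum c′` alone (the hypothesis `hremCore` of
`eq16_16R2E_of_subleaves_core`). [cite: Zhang2022LandauSiegel, §16 (16.15) p.94] -/
theorem inline16_nsetRemovable_core_of_weightSum (c' : ℝ) (hW : Inline16_varpi2WeightSum c') :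
    ∃ C : ℝ, ForAllLarge fun D _ χ => AssumptionA D χ → ∀ j ∈ ({1, 2} : Finset ℕ),
      ‖(∑ n₁ ∈ (Finset.Ico 1 ⌈bigT D⌉₊).filter (fun n₁ => n₁ ∈ nset (frakq D)),
          varpi2 c' χ j n₁ * nuConvChi χ n₁ / (n₁ : ℂ)) -
        ∑ n₁ ∈ Finset.Ico 1 ⌈bigT D⌉₊, varpi2 c' χ j n₁ * nuConvChi χ n₁ / (n₁ : ℂ)‖ ≤
        C * (ell D)⁻¹ :=
  inline16_nsetRemovable_core_of_roughMajorant c' hW (varpi2loc_roughMajorant c')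

end Literature.NumberTheory.LFunctions.Zhang2022.Typed.Section16B
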